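/-
Copyright (c) 2026 the pub-hodgecm-mathlib formalisation cell (harness21).  Prover seat hodgecm-mathlib-K2Liu-p14 (g5) (cross-line VALVE 16 (n) hand at section S6,
dealer R90-C14-plan (g2)), card «E2♭-COUNT» dealt BY NAME 2026-09-05T03:25:25Z, census 03:31Z (spec authority K2E3-p28 (g4) «=» 03:32:39Z).  FILE 1a = the LETTERS
(closed-form rows, level-one obstruction, residual unipotence); FILE 1b `R90S6TorusFixedSpecialCountTypeTwoShallowOne` = the two count heads.  THEOREMS ONLY (no `def`,
no `instance`, no notation, no named-fact hypothesis, no `sorry`); lane `--supports stmt-HodgeConjecture-24833 --as helper` (count-neutral helper).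
-/
import Literature.NumberTheory.Automorphic.UnitaryAntidiagFrames                                -- ★ `B₀`, `mem_unitaryGroupOfForm_antidiagonal_iff`
import Literature.NumberTheory.Rogawski1990.UnitOrbitalIntegralInertClosedFormsTypeTwo          -- ★ Flicker's type-(2) closed forms `phiTHn` ∕ `phiTHprimen` (defs)
import Literature.NumberTheory.LocalFields.ValuedCompleteIsAdicComplete                           -- ★ `v_lt_one_iff_v_le_of_v_eq` (the value group is `ℤ`)
import Literature.LinearAlgebra.Matrix.CubicDiscriminantDiagonalScaling                          -- ★ `charpoly_fin_three_explicit`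
import HarnessLib

/-!
# R90 · S6 — card «E2♭-COUNT» FILE 1a `R90S6TorusFixedSpecialCountTypeTwoShallowLetters`: THE LETTERS OF THE SHALLOW SPECIAL COUNTS OF A TYPE-(2) ELEMENT —
# the four closed-form rows at `n ≤ 1`, the level-one obstruction `|disc| ≤ |ϖ²|`, and the residual unipotence `χ_γ ≡ (X − u)³` from the exponent letters

Cell `hodgecm-mathlib`, crux H413 (`stmt-HodgeConjecture-24833`), route `HCCMUnconditional`; programme R90-TF, section S6 (base `R90-C14`), row E1.3.5.2.6, target (E2♭) of
typ1's sheet v2.3 (the type-(2) elliptic identity in the SHALLOW regimes `n ≤ 1`).  CENSUS FINDING (this seat, 03:31Z): the HYPERSPECIAL counts of both `κ`-classes are ★ at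
every depth (★ a₀ `natCard_fixedPoints_unitaryInt_eq_phiTHn_of_eigen`, ★ (G2-ODD) A) — only the SPECIAL-count rungs ★ (R2) ∕ (G2-ODD) C carry `2 ≤ n, 1 ≤ N`.  This file
holds the frame-free LETTERS the shallow special counts need (FILE 1b proves `#Fix_γ(U ⧸ K₁) = 1` from them over ★ rung 1 ∕ ★ W8-i′ FILE 1):
* §0 the four shallow ℚ-rows of Flicker's closed forms: `phiTHn q 0 N = Σ_{k<N+1} q^k`, `phiTHn q 1 0 = 1`, `phiTHprimen q 0 N = 0`, `phiTHprimen q 1 0 = q + 1`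
  (the hyperspecial columns of (E2♭), read off the ★ total closed forms);
* §1 **the level-one obstruction** `v_planeDisc_le_sq_of_congr_scalar_of_eigen`: an integral `3 × 3` matrix `k ≡ c·1 (mod 𝔪)` with an eigenvalue `u` has
  `|(tr k − u)² − 4·det k∕u| ≤ |ϖ²|` (`T₁, E₂` of `k − c·1` are `O(ϖ), O(ϖ²)`, the eigenvalue shift `w = u − c` is `O(ϖ)` at a maximal coordinate of the eigenvector, and
  `(tr k − u)² − 4 det k∕u = T₁² + 2T₁w − 3w² − 4E₂` by the root relation `det(k − u·1) = 0`) — so when the plane discriminant has valuation EXACTLY `|ϖ|` (`N = 0`) no fixed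
  hyperspecial vertex has residually scalar local monodromy (★ rung 1's `ℓ₁ = 0`);
* §2 `charpoly_sub_pow_three_coeff_lt_one_of_eigen`: the residual unipotence `χ_γ ≡ (X − u)³ (mod 𝔪)` INTRINSICALLY from ★ a₀'s exponent letters (`|disc| < 1` — every `N`,
  `|χ₂(u)| < 1` — `1 ≤ n`): the `hχ` of ★ rung 1 at `c := u` without ★ (R2.d)'s `2 ≤ n, 1 ≤ N` and without the literal frame (`e₂(γ) = p + us` by the root relation,
  `χ_γ − (X−u)³ = −(s−2u)X² + ((p−u²) + u(s−2u))X − u(p−u²)`, `(s−2u)² = disc + 4·χ₂(u)`, `p − u² = χ₂(u) + u(s−2u)`), and `norm_eigenvalue_eq_one_of_anisotropic`: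
  `σu·u = 1`, `|u| = 1` for the eigenvalue of an anisotropic eigenvector of a unitary element (`B₀(γx, γx) = B₀(x, x)`).
HONEST LABEL: letters only (valuation algebra over a valued field and ℚ-evaluations of ★ definitions); proves no printed global statement, discharges no citation;
count-neutral helper.  HC_CM is proved only modulo the 7 printed citations (2 remaining named inputs: hLiu418 = stmt-HodgeConjecture-24832, h413 = stmt-HodgeConjecture-24833)
until rung 0 closes.

## References
* [Flicker1998UnitaryFL] Y. Z. Flicker, *Elementary proof of the fundamental lemma for a unitary group*, Canad. J. Math. 50 (1998), Prop. 11 p. 87, Props. 16–17 pp. 96–97,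
  Theorem 18 p. 97 (the `N = 0` row: `Φ − Φ′ = −q`).
* [Rogawski1990] J. D. Rogawski, *Automorphic Representations of Unitary Groups in Three Variables* (1990), §1.9 p. 8, §3.6 Lemma 3.6.1, §3.9 p. 32, §4.9 Prop. 4.9.1 (b) pp. 54–56.
* [Kottwitz1988] R. E. Kottwitz, *Tamagawa numbers*, Ann. of Math. 127 (1988), §2 (fixed subtrees; the two parahoric levels).
* [Serre1980Trees] J.-P. Serre, *Trees* (1980), II.1.1 (the valuation ball bookkeeping).
-/

set_option autoImplicit false
-- the mandated namespace repeats the single-problem summit's segment (`HodgeConjecture.HodgeConjecture`)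
set_option linter.dupNamespace false

noncomputable section

open Polynomial
open Literature.NumberTheory.Automorphic Literature.NumberTheory.Automorphic.HermitianLattice
open Literature.NumberTheory.Rogawski1990.Flicker1998 (phiTHn phiTHM phiTHprimen phiTHprimeM)
open Literature.NumberTheory.LocalFields (v_lt_one_iff_v_le_of_v_eq)
open Literature.LinearAlgebra.Matrix (charpoly_fin_three_explicit)
open scoped Matrix MatrixGroups WithZero Valued

namespace Summit.HodgeConjecture.HodgeConjecture.R90.S6

/-! ## §0 The four shallow rows of Flicker's type-(2) closed forms -/

/-- **`Φ(t)` at `n = 0` (the boundary stratum `M = 0`, any `N`)**: `phiTHn q 0 N = Σ_{k<N+1} q^k` (`= (q^{N+1} − 1)∕(q − 1)`, the hyperspecial ball count of the plane part),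
for `q > 1`. [cite: Flicker1998UnitaryFL, Prop. 11 p. 87; Theorem 18 p. 97] -/
theorem phiTHn_zero_left_eq_sum {q : ℕ} (hq : 1 < q) (N : ℕ) : phiTHn q 0 N = ∑ k ∈ Finset.range (N + 1), (q : ℚ) ^ k := by
  have h1 : (q : ℚ) - 1 ≠ 0 := by
    have : (1 : ℚ) < q := by exact_mod_cast hq
    linarith
  have h2 : (q : ℚ) ^ 2 + 1 ≠ 0 := by positivity
  rw [geom_sum_eq (by intro h; exact h1 (by rw [h, sub_self])) (N + 1)]
  simp only [phiTHn, phiTHM, Nat.zero_mod, Nat.zero_div, if_true, Nat.not_lt_zero, if_false, show ¬ (0 % 2 = 1) by decide]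
  field_simp

/-- **`Φ(t)` at `n = 1`** (`N = 0`, residually non-semisimple reduction): `phiTHn q 1 0 = 1` (only the root is fixed), for `q > 1`. [cite: Flicker1998UnitaryFL, Prop. 11 p. 87] -/
theorem phiTHn_one_zero {q : ℕ} (hq : 1 < q) : phiTHn q 1 0 = 1 := by
  have h1 : (q : ℚ) - 1 ≠ 0 := by
    have : (1 : ℚ) < q := by exact_mod_cast hq
    linarith
  have h2 : (q : ℚ) ^ 2 + 1 ≠ 0 := by positivity
  simp only [phiTHn, phiTHM, show ¬ (1 % 2 = 0) by decide, if_false, zero_add, Nat.zero_lt_one, if_true, Nat.zero_mod, show ¬ (0 = 1) by decide]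
  field_simp
  ring

/-- **`Φ′(t″)` at `n = 0`**: `phiTHprimen q 0 N = 0` (the `κ = −1` class fixes no hyperspecial vertex: a self-dual eigenline has even length). [cite: Flicker1998UnitaryFL, Prop. 17 p. 97] -/
theorem phiTHprimen_zero_left (q N : ℕ) : phiTHprimen q 0 N = 0 := by
  simp [phiTHprimen, phiTHprimeM]

/-- **`Φ′(t″)` at `n = 1`** (`N = 0`): `phiTHprimen q 1 0 = q + 1`, for `q > 1` (so `Φ − Φ′ = 1 − (q+1) = −q = (−q)¹·Φ_H`, Theorem 18's `N = 0` row).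
[cite: Flicker1998UnitaryFL, Prop. 17 p. 97; Theorem 18 p. 97] -/
theorem phiTHprimen_one_zero {q : ℕ} (hq : 1 < q) : phiTHprimen q 1 0 = (q : ℚ) + 1 := by
  have h1 : (q : ℚ) - 1 ≠ 0 := by
    have : (1 : ℚ) < q := by exact_mod_cast hq
    linarith
  have h2 : (q : ℚ) ^ 2 + 1 ≠ 0 := by positivity
  simp only [phiTHprimen, phiTHprimeM, show ¬ (1 % 2 = 0) by decide, if_false, zero_add, Nat.zero_lt_one, if_true, Nat.zero_div]
  norm_num
  field_simp
  ring

/-! ## §1 The level-one obstruction: a residually scalar integral matrix has plane discriminant `O(ϖ²)` at any eigenvalue -/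

section Obstruction

variable {K : Type*} [Field K] [Valued K ℤᵐ⁰]

/-- Ultrametric bookkeeping: `|a|, |b| ≤ t ⇒ |a + b| ≤ t`. [cite: Serre1980Trees, II.1.1] -/
private theorem shallow_v_add_le {a b : K} {t : ℤᵐ⁰} (ha : Valued.v a ≤ t) (hb : Valued.v b ≤ t) : Valued.v (a + b) ≤ t :=
  (Valuation.map_add _ _ _).trans (max_le ha hb)

/-- Ultrametric bookkeeping: `|a|, |b| ≤ t ⇒ |a − b| ≤ t`. [cite: Serre1980Trees, II.1.1] -/
private theorem shallow_v_sub_le {a b : K} {t : ℤᵐ⁰} (ha : Valued.v a ≤ t) (hb : Valued.v b ≤ t) : Valued.v (a - b) ≤ t :=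
  (Valuation.map_sub _ _ _).trans (max_le ha hb)

/-- Ultrametric bookkeeping: `|a|, |b| ≤ |ϖ| ⇒ |a·b| ≤ |ϖ²|`. [cite: Serre1980Trees, II.1.1] -/
private theorem shallow_v_mul_le_sq {ϖ a b : K} (ha : Valued.v a ≤ Valued.v ϖ) (hb : Valued.v b ≤ Valued.v ϖ) :
    Valued.v (a * b) ≤ Valued.v (ϖ ^ 2) := by
  rw [map_mul, map_pow, pow_two]
  exact mul_le_mul' ha hb

/-- Ultrametric bookkeeping: a natural-number multiple does not increase the valuation. [cite: Serre1980Trees, II.1.1] -/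
private theorem shallow_v_natMul_le {a : K} {t : ℤᵐ⁰} (n : ℕ) (ha : Valued.v a ≤ t) : Valued.v ((n : K) * a) ≤ t := by
  rw [map_mul]
  calc Valued.v (n : K) * Valued.v a ≤ 1 * t := mul_le_mul' ((Valuation.mem_integer_iff _ _).1 (natCast_mem 𝒪[K] n)) ha
    _ = t := one_mul t

/-- **THE LEVEL-ONE OBSTRUCTION.**  Let `k ∈ M₃(K)` be congruent to the scalar `c` (`|c| = 1`) modulo the maximal ideal entrywise — the LEVEL-ONE condition of ★ rung 1,
`|k_{ij} − c·δ_{ij}| < 1` — and let `u` be an eigenvalue of `k` (`kx = ux`, `x ≠ 0`).  Then the discriminant of the complementary quadratic factor of `χ_k` at `u` is `O(ϖ²)`: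
`|(tr k − u)² − 4·det k∕u| ≤ |ϖ²|`.  (With `Z = k − c·1`: `T₁ = tr Z = O(ϖ)`, `E₂ = e₂(Z) = O(ϖ²)`; the eigenvalue shift `w = u − c` satisfies `|w·x_{i₀}| = |(Zx)_{i₀}| ≤ |ϖ|·|x_{i₀}|`
at a maximal coordinate; and the root relation `det(k − u·1) = 0` turns `(tr k − u)² − 4 det k∕u` into `T₁² + 2T₁w − 3w² − 4E₂`.)  Consequence (§3): an element whose plane
discriminant has valuation exactly `|ϖ|` (`N = 0`) has NO fixed hyperspecial vertex of level one. [cite: Kottwitz1988, §2] [cite: Rogawski1990, §3.9 p. 32] -/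
theorem v_planeDisc_le_sq_of_congr_scalar_of_eigen {ϖ : K} (hϖ : Valued.v ϖ = WithZero.exp (-1 : ℤ))
    {k : Matrix (Fin 3) (Fin 3) K} {c u : K} {x : Fin 3 → K} (hc : Valued.v c = 1)
    (hk : ∀ i j, Valued.v (k i j - c * (1 : Matrix (Fin 3) (Fin 3) K) i j) < 1)
    (hkx : k *ᵥ x = u • x) (hx : x ≠ 0) :
    Valued.v ((Matrix.trace k - u) ^ 2 - 4 * (Matrix.det k / u)) ≤ Valued.v (ϖ ^ 2) := by
  -- entries of `Z = k − c·1`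
  have hle : ∀ i j, Valued.v (k i j - c * (1 : Matrix (Fin 3) (Fin 3) K) i j) ≤ Valued.v ϖ := fun i j =>
    (v_lt_one_iff_v_le_of_v_eq hϖ _).1 (hk i j)
  have hdg : ∀ i, Valued.v (k i i - c) ≤ Valued.v ϖ := fun i => by simpa [Matrix.one_apply_eq] using hle i i
  have hof : ∀ i j, i ≠ j → Valued.v (k i j) ≤ Valued.v ϖ := fun i j hij => by simpa [Matrix.one_apply_ne hij] using hle i j
  have hϖ1 : Valued.v ϖ < 1 := by rw [hϖ, ← WithZero.exp_zero, WithZero.exp_lt_exp]; norm_num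
  -- the eigenvalue shift `w = u − c` is `O(ϖ)`: look at a maximal coordinate of `x`
  obtain ⟨i₀, -, hi₀⟩ := Finset.exists_max_image Finset.univ (fun i => Valued.v (x i)) Finset.univ_nonempty
  have hxi₀ : x i₀ ≠ 0 := by
    intro h0
    apply hx
    funext i
    have hi := hi₀ i (Finset.mem_univ i)
    rw [h0, map_zero, le_zero_iff, map_eq_zero] at hi
    exact hi
  have hrow : ∀ i, (u - c) * x i = ∑ j, (k i j - c * (1 : Matrix (Fin 3) (Fin 3) K) i j) * x j := by
    intro i
    have h := congrFun hkx i
    simp only [Matrix.mulVec, dotProduct, Pi.smul_apply, smul_eq_mul] at h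
    have h1 : ∑ j, c * (1 : Matrix (Fin 3) (Fin 3) K) i j * x j = c * x i := by
      simp only [Matrix.one_apply, mul_ite, mul_one, mul_zero, ite_mul, zero_mul, Finset.sum_ite_eq, Finset.mem_univ, if_true]
    simp only [sub_mul, Finset.sum_sub_distrib, h, h1]
  have hw : Valued.v (u - c) ≤ Valued.v ϖ := by
    have hb : Valued.v ((u - c) * x i₀) ≤ Valued.v ϖ * Valued.v (x i₀) := by
      rw [hrow i₀]
      refine Valuation.map_sum_le _ (fun j _ => ?_)
      rw [map_mul]
      exact mul_le_mul' (hle _ _) (hi₀ _ (Finset.mem_univ _))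
    rw [map_mul] at hb
    have hne : Valued.v (x i₀) ≠ 0 := (Valuation.ne_zero_iff _).2 hxi₀
    have := mul_le_mul' hb (le_refl (Valued.v (x i₀))⁻¹)
    rwa [mul_inv_cancel_right₀ hne, mul_inv_cancel_right₀ hne] at this
  -- `|u| = 1`, in particular `u ≠ 0`
  have hvu : Valued.v u = 1 := by
    have e : u = c + (u - c) := by ring
    rw [e, Valuation.map_add_eq_of_lt_left]
    · exact hc
    · rw [hc]; exact hw.trans_lt hϖ1
  have hu0 : u ≠ 0 := fun h0 => by rw [h0, map_zero] at hvu; exact zero_ne_one hvu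
  -- the root relation `det (k − u·1) = 0`
  have hroot : (k - u • (1 : Matrix (Fin 3) (Fin 3) K)).det = 0 :=
    Matrix.exists_mulVec_eq_zero_iff.1 ⟨x, hx, by rw [Matrix.sub_mulVec, Matrix.smul_mulVec, Matrix.one_mulVec, hkx, sub_self]⟩
  have hroot' := hroot
  simp [Matrix.det_fin_three, Matrix.sub_apply, Matrix.smul_apply] at hroot'
  -- the identity `(tr k − u)² − 4 det k∕u = T₁² + 2T₁w − 3w² − 4E₂`
  have key : (Matrix.trace k - u) ^ 2 - 4 * (Matrix.det k / u) =
      ((k 0 0 - c) + (k 1 1 - c) + (k 2 2 - c)) ^ 2 + 2 * (((k 0 0 - c) + (k 1 1 - c) + (k 2 2 - c)) * (u - c)) - 3 * ((u - c) * (u - c)) -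
        4 * ((k 0 0 - c) * (k 1 1 - c) - k 0 1 * k 1 0 + ((k 0 0 - c) * (k 2 2 - c) - k 0 2 * k 2 0) + ((k 1 1 - c) * (k 2 2 - c) - k 1 2 * k 2 1)) := by
    refine mul_left_cancel₀ hu0 ?_
    rw [mul_sub, show u * (4 * (Matrix.det k / u)) = 4 * Matrix.det k by rw [mul_comm u, mul_assoc, div_mul_cancel₀ _ hu0],
      Matrix.trace_fin_three, Matrix.det_fin_three]
    linear_combination (-4) * hroot'
  rw [key]
  -- every term is `O(ϖ²)`
  have hT : Valued.v ((k 0 0 - c) + (k 1 1 - c) + (k 2 2 - c)) ≤ Valued.v ϖ := shallow_v_add_le (shallow_v_add_le (hdg 0) (hdg 1)) (hdg 2)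
  have hE : Valued.v ((k 0 0 - c) * (k 1 1 - c) - k 0 1 * k 1 0 + ((k 0 0 - c) * (k 2 2 - c) - k 0 2 * k 2 0) + ((k 1 1 - c) * (k 2 2 - c) - k 1 2 * k 2 1)) ≤
      Valued.v (ϖ ^ 2) :=
    shallow_v_add_le (shallow_v_add_le (shallow_v_sub_le (shallow_v_mul_le_sq (hdg 0) (hdg 1)) (shallow_v_mul_le_sq (hof 0 1 (by decide)) (hof 1 0 (by decide))))
      (shallow_v_sub_le (shallow_v_mul_le_sq (hdg 0) (hdg 2)) (shallow_v_mul_le_sq (hof 0 2 (by decide)) (hof 2 0 (by decide)))))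
      (shallow_v_sub_le (shallow_v_mul_le_sq (hdg 1) (hdg 2)) (shallow_v_mul_le_sq (hof 1 2 (by decide)) (hof 2 1 (by decide))))
  refine shallow_v_sub_le (shallow_v_sub_le (shallow_v_add_le ?_ (shallow_v_natMul_le 2 (shallow_v_mul_le_sq hT hw))) (shallow_v_natMul_le 3 (shallow_v_mul_le_sq hw hw)))
    (shallow_v_natMul_le 4 hE)
  rw [pow_two]
  exact shallow_v_mul_le_sq hT hT

end Obstruction

/-! ## §2 Residual unipotence `χ_γ ≡ (X − u)³ (mod 𝔪)` from the exponent letters, and `|u| = 1` from the anisotropic eigenvector -/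

section Unipotence

variable {K : Type*} [Field K] [Valued K ℤᵐ⁰]

/-- In `ℤᵐ⁰`: `a² < 1 ⇒ a < 1`. [cite: Serre1980Trees, II.1.1] -/
private theorem shallow_lt_one_of_sq_lt_one {a : ℤᵐ⁰} (h : a * a < 1) : a < 1 := by
  by_contra hge
  rw [not_lt] at hge
  exact absurd (one_le_mul hge hge) (not_le.2 h)

/-- **RESIDUAL UNIPOTENCE FROM THE EXPONENT LETTERS.**  For `G ∈ M₃(K)` with an eigenvector `Gx = ux` (`x ≠ 0`, `|u| = 1`) whose complementary quadratic factor at `u` has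
discriminant AND value at `u` in the maximal ideal — `|(tr G − u)² − 4·det G∕u| < 1` (★ a₀'s `hN`, every `N`) and `|u² − (tr G − u)u + det G∕u| < 1` (★ a₀'s `hn`, `1 ≤ n`) —
the characteristic polynomial is residually `(X − u)³`: every coefficient of `χ_G − (X − u)³` lies in the maximal ideal (the `hχ` of ★ rung 1 at `c := u`; ★ (R2.d) proves it
through the literal frame under `2 ≤ n, 1 ≤ N` — here intrinsically and at every depth `n ≥ 1`).  With `s = tr G − u`, `p = det G∕u`: `e₂(G) = p + us` (root relation),
`χ_G − (X−u)³ = −(s−2u)X² + ((p−u²) + u(s−2u))X − u(p−u²)`, `(s−2u)² = disc + 4·Q(u)`, `p − u² = Q(u) + u(s−2u)`. [cite: Rogawski1990, §3.9 p. 32; §4.9 p. 55] [cite: Flicker1998UnitaryFL, Theorem 18 p. 97] -/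
theorem charpoly_sub_pow_three_coeff_lt_one_of_eigen {G : Matrix (Fin 3) (Fin 3) K} {u : K} {x : Fin 3 → K}
    (hGx : G *ᵥ x = u • x) (hx : x ≠ 0) (hvu : Valued.v u = 1)
    (hD : Valued.v ((Matrix.trace G - u) ^ 2 - 4 * (Matrix.det G / u)) < 1)
    (hQ : Valued.v (u ^ 2 - (Matrix.trace G - u) * u + Matrix.det G / u) < 1) (i : ℕ) :
    Valued.v ((G.charpoly - (X - C u) ^ 3).coeff i) < 1 := by
  have hu0 : u ≠ 0 := fun h0 => by rw [h0, map_zero] at hvu; exact zero_ne_one hvu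
  have hvule : Valued.v u ≤ 1 := hvu.le
  -- the root relation `det (G − u·1) = 0`, and `e₂(G) = det G∕u + u·(tr G − u)`
  have hroot : (G - u • (1 : Matrix (Fin 3) (Fin 3) K)).det = 0 :=
    Matrix.exists_mulVec_eq_zero_iff.1 ⟨x, hx, by rw [Matrix.sub_mulVec, Matrix.smul_mulVec, Matrix.one_mulVec, hGx, sub_self]⟩
  simp [Matrix.det_fin_three, Matrix.sub_apply, Matrix.smul_apply] at hroot
  have hε : G 0 0 * G 1 1 - G 0 1 * G 1 0 + (G 0 0 * G 2 2 - G 0 2 * G 2 0) + (G 1 1 * G 2 2 - G 1 2 * G 2 1) =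
      Matrix.det G / u + u * (Matrix.trace G - u) := by
    rw [Matrix.trace_fin_three, Matrix.det_fin_three]
    field_simp
    linear_combination (-1) * hroot
  -- the difference polynomial
  have hdiff : G.charpoly - (X - C u) ^ 3 =
      C (-((Matrix.trace G - u) - 2 * u)) * X ^ 2 +
        C ((Matrix.det G / u - u ^ 2) + u * ((Matrix.trace G - u) - 2 * u)) * X + C (-(u * (Matrix.det G / u - u ^ 2))) := by
    have e1 : (Matrix.det G / u - u ^ 2) + u * ((Matrix.trace G - u) - 2 * u) =
        (G 0 0 * G 1 1 - G 0 1 * G 1 0 + (G 0 0 * G 2 2 - G 0 2 * G 2 0) + (G 1 1 * G 2 2 - G 1 2 * G 2 1)) - 3 * u ^ 2 := by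
      rw [hε]; ring
    have e0 : -(u * (Matrix.det G / u - u ^ 2)) = -Matrix.det G + u ^ 3 := by
      field_simp
      ring
    rw [e1, e0, charpoly_fin_three_explicit, Matrix.trace_fin_three, Matrix.det_fin_three]
    simp only [map_add, map_sub, map_mul, map_neg, map_pow, map_ofNat]
    ring
  -- the two small quantities
  have hA : Valued.v ((Matrix.trace G - u) - 2 * u) < 1 := by
    refine shallow_lt_one_of_sq_lt_one ?_
    rw [← map_mul, show ((Matrix.trace G - u) - 2 * u) * ((Matrix.trace G - u) - 2 * u) =
      ((Matrix.trace G - u) ^ 2 - 4 * (Matrix.det G / u)) + 4 * (u ^ 2 - (Matrix.trace G - u) * u + Matrix.det G / u) by ring]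
    refine (Valuation.map_add _ _ _).trans_lt (max_lt hD ?_)
    rw [map_mul]
    calc Valued.v (4 : K) * Valued.v (u ^ 2 - (Matrix.trace G - u) * u + Matrix.det G / u)
        ≤ 1 * Valued.v (u ^ 2 - (Matrix.trace G - u) * u + Matrix.det G / u) :=
          mul_le_mul' ((Valuation.mem_integer_iff _ _).1 (by exact_mod_cast natCast_mem 𝒪[K] 4)) le_rfl
      _ < 1 := by rw [one_mul]; exact hQ
  have hB : Valued.v (Matrix.det G / u - u ^ 2) < 1 := by
    rw [show Matrix.det G / u - u ^ 2 = (u ^ 2 - (Matrix.trace G - u) * u + Matrix.det G / u) + u * ((Matrix.trace G - u) - 2 * u) by ring]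
    refine (Valuation.map_add _ _ _).trans_lt (max_lt hQ ?_)
    rw [map_mul]
    calc Valued.v u * Valued.v ((Matrix.trace G - u) - 2 * u) ≤ 1 * Valued.v ((Matrix.trace G - u) - 2 * u) := mul_le_mul' hvule le_rfl
      _ < 1 := by rw [one_mul]; exact hA
  -- coefficientwise
  have hc0 : Valued.v (-(u * (Matrix.det G / u - u ^ 2))) < 1 := by
    rw [Valuation.map_neg, map_mul]
    calc Valued.v u * Valued.v (Matrix.det G / u - u ^ 2) ≤ 1 * Valued.v (Matrix.det G / u - u ^ 2) := mul_le_mul' hvule le_rfl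
      _ < 1 := by rw [one_mul]; exact hB
  have hc1 : Valued.v ((Matrix.det G / u - u ^ 2) + u * ((Matrix.trace G - u) - 2 * u)) < 1 := by
    refine (Valuation.map_add _ _ _).trans_lt (max_lt hB ?_)
    rw [map_mul]
    calc Valued.v u * Valued.v ((Matrix.trace G - u) - 2 * u) ≤ 1 * Valued.v ((Matrix.trace G - u) - 2 * u) := mul_le_mul' hvule le_rfl
      _ < 1 := by rw [one_mul]; exact hA
  have hc2 : Valued.v (-((Matrix.trace G - u) - 2 * u)) < 1 := by rw [Valuation.map_neg]; exact hA
  rw [hdiff]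
  simp only [coeff_add, coeff_C_mul, coeff_X_pow, coeff_X, coeff_C]
  rcases i with _ | _ | _ | i
  · simpa using hc0
  · simpa using hc1
  · simpa using hc2
  · have h2 : i + 1 + 1 + 1 ≠ 2 := by omega
    simp [h2]

/-- **`σu·u = 1` and `|u| = 1` for the eigenvalue of an ANISOTROPIC eigenvector of a unitary element** (`B₀(γx, γx) = B₀(x, x) = σu·u·B₀(x, x)`, `B₀(x,x) ≠ 0`; `|σu| = |u|`).
[cite: Rogawski1990, §1.9 p. 8; §3.6 pp. 28–29] -/
theorem norm_eigenvalue_eq_one_of_anisotropic {σ : K →+* K} (hvσ : ∀ a, Valued.v (σ a) = Valued.v a)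
    {γ : ↥(unitaryGroupOfForm σ ((StdForm.antidiagonal 3).over K))} {x : Fin 3 → K} {u : K}
    (hγx : (((γ : ↥(unitaryGroupOfForm σ ((StdForm.antidiagonal 3).over K))) : GL (Fin 3) K) : Matrix (Fin 3) (Fin 3) K) *ᵥ x = u • x)
    (hx : B₀ σ 3 x x ≠ 0) : σ u * u = 1 ∧ Valued.v u = 1 := by
  have hinv := (mem_unitaryGroupOfForm_antidiagonal_iff (σ := σ) ((γ : ↥(unitaryGroupOfForm σ ((StdForm.antidiagonal 3).over K))) : GL (Fin 3) K)).1 γ.2 x x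
  rw [hγx, LinearMap.map_smulₛₗ₂, LinearMap.map_smul, smul_eq_mul, smul_eq_mul, ← mul_assoc] at hinv
  have hσu : σ u * u = 1 := mul_right_cancel₀ hx (by rw [hinv, one_mul])
  refine ⟨hσu, ?_⟩
  have h := congrArg Valued.v hσu
  rw [map_mul, hvσ, map_one] at h
  have hvu0 : Valued.v u ≠ 0 := fun h0 => by rw [h0, mul_zero] at h; exact zero_ne_one h
  rw [← WithZero.exp_log hvu0, ← WithZero.exp_add, ← WithZero.exp_zero, WithZero.exp_inj] at h
  rw [← WithZero.exp_log hvu0, ← WithZero.exp_zero]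
  congr 1
  omega

end Unipotence

end Summit.HodgeConjecture.HodgeConjecture.R90.S6

end
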